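import Mathlib.Analysis.Convex.PathConnected
import Literature.Topology.PlaneTopology.EilenbergCriterion
import HarnessLib

/-!
# Increment of the argument along a path; the crossing-parity rule for winding numbers

Topic: Topology / PlaneTopology (companion to `WindingNumber.lean`, `EilenbergCriterion.lean`).
Elementary bookkeeping for winding numbers of *concatenated* loops, used downstream to show that
two points on opposite sides of one straight piece of a polygonal loop have different winding
numbers ("the winding number jumps by `±1` across a transversal crossing"), without any appeal to
the Jordan curve theorem:

* `logInc f`: the increment `l 1 - l 0` of a (any) continuous logarithm `l` of `f : ℝ → ℂ` on
  `[0, 1]` (`2πi · wind f` for a loop, `logInc_eq_wind_mul`); algebra (`logInc_mul`,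
  `logInc_div`), the principal-branch value `log (f 1) - log (f 0)` when `f` avoids the cut
  `(-∞, 0]` (`logInc_eq_log_sub_log`), and splitting at `t = 1/2` (`logInc_eq_add_halves`).
* `Path.argInc γ p = logInc (γ - p)`, the variation of the argument of `z - p` along a path
  `γ` in `ℂ`: additive under `Path.trans`, odd under `Path.symm`, zero on `Path.refl`, and
  `2πi · wind` on loops (`Path.argInc_eq_wind_mul`).
* `Path.crossInc γ ℓ r`: the defect `logInc (F ∘ γ) - (log F(γ 1) - log F(γ 0))` for the Möbius
  map `F z = (z - ℓ)/(z - r)` (`crossRatioFn`), which sends the segment `[ℓ, r)` onto the cut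
  `(-∞, 0]`. It is additive under concatenation, vanishes on paths avoiding the segment `[ℓ, r]`
  (`Path.crossInc_eq_zero`), equals `±2πi` on a straight segment crossing `[ℓ, r]` once
  transversally (`Path.crossInc_segment_of_cross`), and on a loop equals
  `2πi (wind (γ - ℓ) - wind (γ - r))` (`Path.crossInc_loop`).
* `wind_sub_eq_of_mem_connectedComponentIn`: points in one complementary component of a closed
  set carrying the loop have the same winding number (Eilenberg's easy direction, from
  `EilenbergCriterion.lean`), and the resulting separation of "side pairs"
  (`sidePairs_ne_of_wind`).

All statements are folklore (argument-principle bookkeeping; e.g. Ahlfors, *Complex Analysis*,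
3rd ed., §4.2.1, Lemmas 1–2 on the winding number and its jump across an arc). Everything is
proved.
-/

noncomputable section

open Complex Set Topology Filter
open scoped Real

namespace Literature.Topology.PlaneTopology

/-! ### The increment of a continuous logarithm along `[0, 1]` -/

/-- The **increment of the logarithm** of `f : ℝ → ℂ` along `[0, 1]`: `l 1 - l 0` for a
continuous logarithm `l` of `f` on `[0, 1]` (independent of the choice, `logInc_eq`); junk value
`0` if `f` has no continuous logarithm there (e.g. if it vanishes). Its imaginary part is the
variation of the argument of `f`. [folklore] -/
def logInc (f : ℝ → ℂ) : ℂ := by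
  classical
  exact if h : HasLogOn f (Icc 0 1) then h.choose 1 - h.choose 0 else 0

/-- `0 ∈ [0, 1]`. [folklore] -/
theorem zero_mem_Icc01 : (0 : ℝ) ∈ Icc (0 : ℝ) 1 := ⟨le_rfl, zero_le_one⟩

/-- `1 ∈ [0, 1]`. [folklore] -/
theorem one_mem_Icc01 : (1 : ℝ) ∈ Icc (0 : ℝ) 1 := ⟨zero_le_one, le_rfl⟩

/-- **Independence of the logarithm**: `logInc f = l 1 - l 0` for every continuous logarithm `l`
of `f` on `[0, 1]`. [folklore] -/
theorem logInc_eq {f l : ℝ → ℂ} (hl : ContinuousOn l (Icc 0 1))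
    (hle : ∀ t ∈ Icc (0 : ℝ) 1, exp (l t) = f t) : logInc f = l 1 - l 0 := by
  classical
  have h : HasLogOn f (Icc 0 1) := ⟨l, hl, hle⟩
  rw [logInc, dif_pos h]
  obtain ⟨n, hn⟩ := exists_int_eq_add_of_exp_eq isPreconnected_Icc h.choose_spec.1 hl
    (fun t ht => by rw [h.choose_spec.2 t ht, hle t ht])
  rw [hn 1 one_mem_Icc01, hn 0 zero_mem_Icc01]
  ring

/-- Without a continuous logarithm the increment is the junk value `0`. [folklore] -/
theorem logInc_of_not_hasLogOn {f : ℝ → ℂ} (h : ¬ HasLogOn f (Icc 0 1)) : logInc f = 0 := by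
  classical
  rw [logInc, dif_neg h]

/-- For a loop, the increment of the logarithm is `2πi` times the winding number. [folklore] -/
theorem logInc_eq_wind_mul {f : ℝ → ℂ} (hf : IsNonvanishingLoop f) :
    logInc f = wind f * (2 * π * I) := by
  obtain ⟨l, hl, hle⟩ := hf.hasLogOn
  rw [logInc_eq hl hle, wind_spec hl hle hf.eq_endpoints]

/-- The increment only depends on `f` on `[0, 1]`. [folklore] -/
theorem logInc_congr {f g : ℝ → ℂ} (h : EqOn f g (Icc 0 1)) : logInc f = logInc g := by
  by_cases hf : HasLogOn f (Icc 0 1)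
  · obtain ⟨l, hl, hle⟩ := hf
    rw [logInc_eq hl hle, logInc_eq hl fun t ht => (hle t ht).trans (h ht)]
  · have hg : ¬ HasLogOn g (Icc 0 1) := fun hg => hf (hg.congr h.symm)
    rw [logInc_of_not_hasLogOn hf, logInc_of_not_hasLogOn hg]

/-- Increments add under products (of maps with continuous logarithms). [folklore] -/
theorem logInc_mul {f g : ℝ → ℂ} (hf : HasLogOn f (Icc 0 1)) (hg : HasLogOn g (Icc 0 1)) :
    logInc (fun t => f t * g t) = logInc f + logInc g := by
  obtain ⟨l, hl, hle⟩ := hf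
  obtain ⟨m, hm, hme⟩ := hg
  rw [logInc_eq hl hle, logInc_eq hm hme,
    logInc_eq (l := fun t => l t + m t) (hl.add hm) fun t ht => by rw [exp_add, hle t ht, hme t ht]]
  ring

/-- Increment of the inverse. [folklore] -/
theorem logInc_inv {f : ℝ → ℂ} (hf : HasLogOn f (Icc 0 1)) :
    logInc (fun t => (f t)⁻¹) = -logInc f := by
  obtain ⟨l, hl, hle⟩ := hf
  rw [logInc_eq hl hle, logInc_eq (l := fun t => -l t) hl.neg fun t ht => by rw [exp_neg, hle t ht]]
  ring

/-- Increments subtract under quotients. [folklore] -/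
theorem logInc_div {f g : ℝ → ℂ} (hf : HasLogOn f (Icc 0 1)) (hg : HasLogOn g (Icc 0 1)) :
    logInc (fun t => f t / g t) = logInc f - logInc g := by
  simp only [div_eq_mul_inv]
  rw [logInc_mul hf hg.inv, logInc_inv hg]
  ring

/-- **Principal branch.** If `f` avoids the cut `(-∞, 0]` on `[0, 1]`, the principal logarithm
is a continuous logarithm and `logInc f = log (f 1) - log (f 0)`. [folklore] -/
theorem logInc_eq_log_sub_log {f : ℝ → ℂ} (hf : ContinuousOn f (Icc 0 1))
    (h : ∀ t ∈ Icc (0 : ℝ) 1, f t ∈ slitPlane) : logInc f = log (f 1) - log (f 0) :=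
  logInc_eq (l := fun t => log (f t)) (hf.clog h) fun t ht => exp_log (slitPlane_ne_zero (h t ht))

/-- A constant has increment `0`. [folklore] -/
theorem logInc_const (c : ℂ) : logInc (fun _ : ℝ => c) = 0 := by
  by_cases hc : c = 0
  · refine logInc_of_not_hasLogOn fun h => ?_
    exact h.ne_zero zero_mem_Icc01 hc
  · rw [logInc_eq (l := fun _ => log c) continuousOn_const fun _ _ => exp_log hc, sub_self]

/-- **Splitting at `t = 1/2`.** The increment along `[0, 1]` is the sum of the increments of
the two halves, each reparametrised by `[0, 1]`. [folklore] -/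
theorem logInc_eq_add_halves {f : ℝ → ℂ} (hf : HasLogOn f (Icc 0 1)) :
    logInc f = logInc (fun t => f (t / 2)) + logInc (fun t => f ((t + 1) / 2)) := by
  obtain ⟨l, hl, hle⟩ := hf
  have h1 : ∀ t ∈ Icc (0 : ℝ) 1, t / 2 ∈ Icc (0 : ℝ) 1 := fun t ht =>
    ⟨by linarith [ht.1], by linarith [ht.2]⟩
  have h2 : ∀ t ∈ Icc (0 : ℝ) 1, (t + 1) / 2 ∈ Icc (0 : ℝ) 1 := fun t ht =>
    ⟨by linarith [ht.1], by linarith [ht.2]⟩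
  have c1 : Continuous fun t : ℝ => t / 2 := by fun_prop
  have c2 : Continuous fun t : ℝ => (t + 1) / 2 := by fun_prop
  rw [logInc_eq hl hle,
    logInc_eq (l := fun t => l (t / 2)) (hl.comp c1.continuousOn h1) fun t ht => hle _ (h1 t ht),
    logInc_eq (l := fun t => l ((t + 1) / 2)) (hl.comp c2.continuousOn h2) fun t ht => hle _ (h2 t ht)]
  rw [show ((0 : ℝ) + 1) / 2 = 1 / 2 by norm_num, show ((1 : ℝ) + 1) / 2 = 1 by norm_num, zero_div]
  ring

/-- Reversal of time negates the increment. [folklore] -/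
theorem logInc_reverse {f : ℝ → ℂ} (hf : HasLogOn f (Icc 0 1)) :
    logInc (fun t => f (1 - t)) = -logInc f := by
  obtain ⟨l, hl, hle⟩ := hf
  have h1 : ∀ t ∈ Icc (0 : ℝ) 1, 1 - t ∈ Icc (0 : ℝ) 1 := fun t ht =>
    ⟨by linarith [ht.2], by linarith [ht.1]⟩
  have c1 : Continuous fun t : ℝ => 1 - t := by fun_prop
  rw [logInc_eq hl hle,
    logInc_eq (l := fun t => l (1 - t)) (hl.comp c1.continuousOn h1) fun t ht => hle _ (h1 t ht)]
  rw [sub_self, sub_zero]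
  ring

/-! ### Winding numbers are constant on complementary components -/

/-- **Eilenberg, easy direction, for winding numbers.** If the loop `Γ|[0,1]` lies in a closed set
`K` and `q` belongs to the component of `p` in `ℂ \ K`, then `Γ` has the same winding number
about `p` and about `q`: `z ↦ (z - p)/(z - q)` has a continuous logarithm on `K`
(`hasLogOn_div_sub_of_mem_connectedComponentIn`), so `wind ((Γ - p)/(Γ - q)) = 0`.
[cite: Eilenberg1936] -/
theorem wind_sub_eq_of_mem_connectedComponentIn {Γ : ℝ → ℂ} (hΓ : ContinuousOn Γ (Icc 0 1))
    (h01 : Γ 0 = Γ 1) {K : Set ℂ} (hK : IsClosed K) (hΓK : MapsTo Γ (Icc 0 1) K) {p q : ℂ}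
    (hq : q ∈ connectedComponentIn Kᶜ p) :
    wind (fun t => Γ t - p) = wind (fun t => Γ t - q) := by
  have hp : p ∈ Kᶜ := by
    have : (connectedComponentIn Kᶜ p).Nonempty := ⟨q, hq⟩
    exact connectedComponentIn_nonempty_iff.1 this
  have hqK : q ∈ Kᶜ := connectedComponentIn_subset _ _ hq
  have hF := hasLogOn_div_sub_of_mem_connectedComponentIn hK hq
  have h0 := wind_comp_eq_zero_of_hasLogOn hF hΓ hΓK h01
  have hlp : IsNonvanishingLoop fun t => Γ t - p :=
    ⟨hΓ.sub continuousOn_const, fun t ht h => hp (by rw [sub_eq_zero] at h; exact h ▸ hΓK ht),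
      by rw [h01]⟩
  have hlq : IsNonvanishingLoop fun t => Γ t - q :=
    ⟨hΓ.sub continuousOn_const, fun t ht h => hqK (by rw [sub_eq_zero] at h; exact h ▸ hΓK ht),
      by rw [h01]⟩
  have := wind_div hlp hlq
  have e : (fun t => (Γ t - p) / (Γ t - q)) = (fun z => (z - p) / (z - q)) ∘ Γ := rfl
  rw [e, h0] at this
  omega

/-! ### The Möbius map `(z - ℓ)/(z - r)` and the side functional of the segment `[ℓ, r]` -/

/-- The Möbius map `F(z) = (z - ℓ)/(z - r)`, sending `ℓ ↦ 0`, `r ↦ ∞` and the segment `[ℓ, r)`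
onto the cut `(-∞, 0]`. [folklore] -/
def crossRatioFn (ℓ r z : ℂ) : ℂ := (z - ℓ) / (z - r)

/-- The **side functional** of the oriented segment `[ℓ, r]`: `Im ((z - ℓ) conj (z - r))`, an
`ℝ`-affine functional of `z` vanishing on the line through `ℓ` and `r`, positive on one open
half-plane and negative on the other; its sign is the sign of `Im F(z)`. [folklore] -/
def segSide (ℓ r z : ℂ) : ℝ := ((z - ℓ) * starRingEnd ℂ (z - r)).im

/-- `Im F(z) = segSide ℓ r z / ‖z - r‖²`. [folklore] -/
theorem crossRatioFn_im (ℓ r z : ℂ) :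
    (crossRatioFn ℓ r z).im = segSide ℓ r z / normSq (z - r) := by
  unfold crossRatioFn segSide
  rw [div_eq_mul_inv, Complex.inv_def, ← mul_assoc, Complex.mul_im]
  simp only [ofReal_re, ofReal_im, mul_zero, zero_add]
  ring

/-- The side functional is affine along segments:
`segSide (lineMap A B t) = (1 - t) segSide A + t segSide B`. [folklore] -/
theorem segSide_lineMap (ℓ r A B : ℂ) (t : ℝ) :
    segSide ℓ r (AffineMap.lineMap A B t) = (1 - t) * segSide ℓ r A + t * segSide ℓ r B := by
  unfold segSide
  rw [AffineMap.lineMap_apply_module]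
  simp only [Complex.mul_im, Complex.sub_re, Complex.sub_im, Complex.conj_re, Complex.conj_im,
    Complex.add_re, Complex.add_im, Complex.smul_re, Complex.smul_im, smul_eq_mul, map_sub]
  ring

/-- The side functional vanishes at `ℓ`. [folklore] -/
@[simp] theorem segSide_left (ℓ r : ℂ) : segSide ℓ r ℓ = 0 := by simp [segSide]

/-- The side functional vanishes at `r`. [folklore] -/
@[simp] theorem segSide_right (ℓ r : ℂ) : segSide ℓ r r = 0 := by simp [segSide]

/-- The side functional vanishes on the segment `[ℓ, r]`. [folklore] -/
theorem segSide_eq_zero_of_mem_segment {ℓ r p : ℂ} (h : p ∈ segment ℝ ℓ r) : segSide ℓ r p = 0 := by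
  rw [segment_eq_image_lineMap] at h
  obtain ⟨v, -, rfl⟩ := h
  rw [segSide_lineMap, segSide_left, segSide_right]
  ring

/-- A point with nonzero side functional witnesses `ℓ ≠ r`. [folklore] -/
theorem ne_of_segSide_ne_zero {ℓ r z : ℂ} (h : segSide ℓ r z ≠ 0) : ℓ ≠ r := by
  rintro rfl
  apply h
  unfold segSide
  rw [Complex.mul_conj, ofReal_im]

/-- A value of `F` off the slit plane comes from a point of the segment `[ℓ, r]`: if
`F(z) ∈ (-∞, 0]` then `z ∈ [ℓ, r]`. [folklore] -/
theorem mem_segment_of_crossRatioFn_not_mem_slitPlane {ℓ r z : ℂ}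
    (h : crossRatioFn ℓ r z ∉ slitPlane) : z ∈ segment ℝ ℓ r := by
  by_cases hzr : z = r
  · subst hzr; exact right_mem_segment _ _ _
  have hzr' : z - r ≠ 0 := sub_ne_zero.2 hzr
  rw [mem_slitPlane_iff, not_or, not_lt, not_ne_iff] at h
  obtain ⟨hre, him⟩ := h
  -- `F z = -s` with `s ≥ 0`
  set w := crossRatioFn ℓ r z with hw
  set s : ℝ := -w.re with hs
  have hs0 : 0 ≤ s := by linarith
  have hwreal : w = -(s : ℂ) := by
    apply Complex.ext <;> simp [him, hs]
  have hzl : z - ℓ = w * (z - r) := by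
    rw [hw, crossRatioFn, div_mul_cancel₀ _ hzr']
  have h1s : (0 : ℝ) < 1 + s := by positivity
  have h1sC : (1 : ℂ) + s ≠ 0 := by
    have : ((1 + s : ℝ) : ℂ) ≠ 0 := by exact_mod_cast h1s.ne'
    push_cast at this
    exact this
  -- `z (1 + s) = ℓ + s r`
  have hz : z = (ℓ + (s : ℂ) * r) / (1 + s) := by
    rw [eq_div_iff h1sC]
    rw [hwreal] at hzl
    linear_combination hzl
  refine ⟨1 / (1 + s), s / (1 + s), by positivity, by positivity, by field_simp, ?_⟩
  rw [hz]
  simp only [Complex.real_smul]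
  push_cast
  field_simp

/-- Off the segment `[ℓ, r]`, `F` takes values in the slit plane. [folklore] -/
theorem crossRatioFn_mem_slitPlane {ℓ r z : ℂ} (h : z ∉ segment ℝ ℓ r) :
    crossRatioFn ℓ r z ∈ slitPlane := by
  by_contra h'
  exact h (mem_segment_of_crossRatioFn_not_mem_slitPlane h')

/-- `F` is continuous away from `r`. [folklore] -/
theorem continuousAt_crossRatioFn {ℓ r z : ℂ} (h : z ≠ r) :
    ContinuousAt (crossRatioFn ℓ r) z := by
  unfold crossRatioFn
  exact (continuousAt_id.sub continuousAt_const).div (continuousAt_id.sub continuousAt_const)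
    (sub_ne_zero.2 h)

/-- `F` does not vanish away from `ℓ` and `r`. [folklore] -/
theorem crossRatioFn_ne_zero {ℓ r z : ℂ} (hl : z ≠ ℓ) (hr : z ≠ r) : crossRatioFn ℓ r z ≠ 0 := by
  unfold crossRatioFn
  exact div_ne_zero (sub_ne_zero.2 hl) (sub_ne_zero.2 hr)

/-- At a point strictly between `ℓ` and `r`, `F` is a negative real number. [folklore] -/
theorem crossRatioFn_of_mem_openSegment {ℓ r z : ℂ} (hlr : ℓ ≠ r) (h : z ∈ openSegment ℝ ℓ r) :
    (crossRatioFn ℓ r z).re < 0 ∧ (crossRatioFn ℓ r z).im = 0 := by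
  obtain ⟨u, v, hu, hv, huv, rfl⟩ := h
  have hu' : u = 1 - v := by linarith
  subst hu'
  have hrl : (r - ℓ : ℂ) ≠ 0 := sub_ne_zero.2 (Ne.symm hlr)
  have h1v : (1 : ℂ) - v ≠ 0 := by
    have : ((1 - v : ℝ) : ℂ) ≠ 0 := by exact_mod_cast (by linarith : (1 - v : ℝ) ≠ 0)
    push_cast at this
    exact this
  have e : crossRatioFn ℓ r ((1 - v) • ℓ + v • r) = ((-(v / (1 - v)) : ℝ) : ℂ) := by
    unfold crossRatioFn
    have h1 : (1 - v) • ℓ + v • r - ℓ = (v : ℂ) * (r - ℓ) := by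
      simp only [Complex.real_smul]; push_cast; ring
    have h2 : (1 - v) • ℓ + v • r - r = -(((1 : ℂ) - v) * (r - ℓ)) := by
      simp only [Complex.real_smul]; push_cast; ring
    rw [h1, h2]
    push_cast
    field_simp
  rw [e]
  refine ⟨?_, ofReal_im _⟩
  rw [ofReal_re]
  exact neg_lt_zero.2 (div_pos hv (by linarith))

/-- Near the cut: for `w` with `Re w < 0` and `Im w ≥ 0` the principal logarithm equals
`log (-w) + πi`. Since `log (-·)` is continuous near the negative axis, this and the next lemma
exhibit the jump of `log` across the cut. [folklore] -/
theorem log_eq_log_neg_add_of_im_nonneg {w : ℂ} (hre : w.re < 0) (him : 0 ≤ w.im) :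
    log w = log (-w) + π * I := by
  apply Complex.ext
  · simp [Complex.log_re]
  · simp only [Complex.log_im, Complex.add_im, Complex.mul_im, Complex.ofReal_re, Complex.I_im,
      Complex.ofReal_im, Complex.I_re, mul_zero, mul_one, add_zero]
    rcases him.lt_or_eq with him | him
    · rw [arg_neg_eq_arg_sub_pi_of_im_pos him]; ring
    · have hw : w = ((w.re : ℝ) : ℂ) := by apply Complex.ext <;> simp [← him]
      rw [hw, arg_ofReal_of_neg hre, ← ofReal_neg, arg_ofReal_of_nonneg (by linarith), zero_add]

/-- For `Im w < 0` the principal logarithm equals `log (-w) - πi`. [folklore] -/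
theorem log_eq_log_neg_sub_of_im_neg {w : ℂ} (him : w.im < 0) :
    log w = log (-w) - π * I := by
  apply Complex.ext
  · simp [Complex.log_re]
  · simp only [Complex.log_im, Complex.sub_im, Complex.mul_im, Complex.ofReal_re, Complex.I_im,
      Complex.ofReal_im, Complex.I_re, mul_zero, mul_one, add_zero]
    rw [arg_neg_eq_arg_add_pi_of_im_neg him]; ring

/-- In a transversal crossing configuration, neither `ℓ` nor `r` lies on `[A, B]`: the only point
of `[A, B]` on the line through `ℓ`, `r` is the crossing point, which is strictly between them.
[folklore] -/
theorem not_mem_segment_of_cross {ℓ r A B : ℂ} (hA : 0 < segSide ℓ r A) (hB : segSide ℓ r B < 0)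
    (hx : ∃ p ∈ segment ℝ A B, p ∈ openSegment ℝ ℓ r) :
    ℓ ∉ segment ℝ A B ∧ r ∉ segment ℝ A B := by
  have hlr : ℓ ≠ r := ne_of_segSide_ne_zero hA.ne'
  obtain ⟨p, hp, hp'⟩ := hx
  rw [segment_eq_image_lineMap] at hp
  obtain ⟨s', -, rfl⟩ := hp
  have h0' := segSide_eq_zero_of_mem_segment (openSegment_subset_segment ℝ _ _ hp')
  rw [segSide_lineMap] at h0'
  have aux : ∀ q, segSide ℓ r q = 0 → q ∈ segment ℝ A B → q = AffineMap.lineMap A B s' := by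
    intro q hq hmem
    rw [segment_eq_image_lineMap] at hmem
    obtain ⟨s, -, rfl⟩ := hmem
    rw [segSide_lineMap] at hq
    have hden : segSide ℓ r A - segSide ℓ r B ≠ 0 := by linarith
    have e1 : s * (segSide ℓ r A - segSide ℓ r B) = segSide ℓ r A := by linarith
    have e2 : s' * (segSide ℓ r A - segSide ℓ r B) = segSide ℓ r A := by linarith
    rw [mul_right_cancel₀ hden (e1.trans e2.symm)]
  constructor
  · intro h
    have := aux ℓ (segSide_left ℓ r) h
    rw [← this] at hp'
    exact hlr (left_mem_openSegment_iff.1 hp')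
  · intro h
    have := aux r (segSide_right ℓ r) h
    rw [← this] at hp'
    exact hlr (right_mem_openSegment_iff.1 hp')

/-- **One transversal crossing of the cut adds `2πi`.** Let `A`, `B` lie strictly on the positive,
resp. negative, side of the segment `[ℓ, r]` (`segSide`), and let the segment `[A, B]` meet the
open segment `(ℓ, r)`. Then along `t ↦ F(lineMap A B t)` the increment of the logarithm is the
principal-branch difference **plus `2πi`**: the image path crosses the cut `(-∞, 0)` exactly
once, from the upper to the lower half-plane. [folklore] -/
theorem logInc_crossRatioFn_lineMap_of_cross {ℓ r A B : ℂ} (hA : 0 < segSide ℓ r A)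
    (hB : segSide ℓ r B < 0) (hx : ∃ p ∈ segment ℝ A B, p ∈ openSegment ℝ ℓ r) :
    logInc (fun t => crossRatioFn ℓ r (AffineMap.lineMap A B t)) =
      log (crossRatioFn ℓ r B) - log (crossRatioFn ℓ r A) + 2 * π * I := by
  have hlr : ℓ ≠ r := ne_of_segSide_ne_zero hA.ne'
  -- notation
  set z : ℝ → ℂ := fun t => AffineMap.lineMap A B t with hz
  set g : ℝ → ℂ := fun t => crossRatioFn ℓ r (z t) with hg
  -- the crossing time
  set τ : ℝ := segSide ℓ r A / (segSide ℓ r A - segSide ℓ r B) with hτ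
  have hden : 0 < segSide ℓ r A - segSide ℓ r B := by linarith
  have hτ0 : 0 < τ := div_pos hA hden
  have hτ1 : τ < 1 := (div_lt_one hden).2 (by linarith)
  have hside' : ∀ t, segSide ℓ r (z t) = (segSide ℓ r A - segSide ℓ r B) * (τ - t) := by
    intro t; rw [hz]; simp only; rw [segSide_lineMap, hτ]; field_simp; ring
  have hpos : ∀ t, t < τ → 0 < segSide ℓ r (z t) := fun t ht => by
    rw [hside']; exact mul_pos hden (by linarith)
  have hneg : ∀ t, τ < t → segSide ℓ r (z t) < 0 := fun t ht => by
    rw [hside']; exact mul_neg_of_pos_of_neg hden (by linarith)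
  have hzero : ∀ t, segSide ℓ r (z t) = 0 → t = τ := fun t ht => by
    rw [hside'] at ht
    rcases mul_eq_zero.1 ht with h | h
    · linarith
    · linarith
  -- the crossing point is `z τ`, strictly between `ℓ` and `r`
  have hzτ : z τ ∈ openSegment ℝ ℓ r := by
    obtain ⟨p, hp, hp'⟩ := hx
    rw [segment_eq_image_lineMap] at hp
    obtain ⟨s, -, rfl⟩ := hp
    have hline := segSide_eq_zero_of_mem_segment (openSegment_subset_segment ℝ _ _ hp')
    have := hzero s hline
    subst this
    exact hp'
  obtain ⟨hgτre, hgτim⟩ := crossRatioFn_of_mem_openSegment hlr hzτ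
  -- `z t ≠ ℓ`, `z t ≠ r`, `g t ≠ 0`, continuity
  have hzne : ∀ t, z t ≠ ℓ ∧ z t ≠ r := by
    intro t
    constructor
    · intro h
      have ht := hzero t (by rw [h]; exact segSide_left ℓ r)
      rw [ht] at h
      rw [h] at hzτ
      exact hlr (left_mem_openSegment_iff.1 hzτ)
    · intro h
      have ht := hzero t (by rw [h]; exact segSide_right ℓ r)
      rw [ht] at h
      rw [h] at hzτ
      exact hlr (right_mem_openSegment_iff.1 hzτ)
  have hzc : Continuous z := AffineMap.lineMap_continuous
  have hgc : ∀ t, ContinuousAt g t := fun t =>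
    (continuousAt_crossRatioFn (hzne t).2).comp hzc.continuousAt
  have hg0 : ∀ t, g t ≠ 0 := fun t => crossRatioFn_ne_zero (hzne t).1 (hzne t).2
  have hgim : ∀ t, (g t).im = segSide ℓ r (z t) / normSq (z t - r) := fun t => crossRatioFn_im _ _ _
  have hnsq : ∀ t, 0 < normSq (z t - r) := fun t => normSq_pos.2 (sub_ne_zero.2 (hzne t).2)
  have hslit : ∀ t, t ≠ τ → g t ∈ slitPlane := by
    intro t ht
    rw [mem_slitPlane_iff]
    right
    rw [hgim]
    rcases lt_or_gt_of_ne ht with h | h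
    · exact (div_pos (hpos t h) (hnsq t)).ne'
    · exact (div_neg_of_neg_of_pos (hneg t h) (hnsq t)).ne
  have him_nonneg : ∀ t, t ≤ τ → 0 ≤ (g t).im := by
    intro t ht
    rcases ht.lt_or_eq with h | h
    · rw [hgim]; exact (div_pos (hpos t h) (hnsq t)).le
    · rw [h]; exact hgτim.symm.le
  have him_neg : ∀ t, τ < t → (g t).im < 0 := fun t ht => by
    rw [hgim]; exact div_neg_of_neg_of_pos (hneg t ht) (hnsq t)
  -- `Re (g t) < 0` near `τ`
  have hre_ev : ∀ᶠ t in 𝓝 τ, (g t).re < 0 :=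
    (hgc τ).eventually ((isOpen_lt continuous_re continuous_const).mem_nhds hgτre)
  -- the continuous logarithm
  set l : ℝ → ℂ := fun t => if t ≤ τ then log (g t) else log (g t) + 2 * π * I with hl
  have hle : ∀ t, exp (l t) = g t := by
    intro t
    simp only [hl]
    split_ifs
    · exact exp_log (hg0 t)
    · rw [exp_add, exp_log (hg0 t), Complex.exp_two_pi_mul_I, mul_one]
  have hlc : ∀ t, ContinuousAt l t := by
    intro t
    rcases lt_trichotomy t τ with ht | rfl | ht
    · -- locally `l = log ∘ g`
      have hev : l =ᶠ[𝓝 t] fun s => log (g s) := by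
        filter_upwards [Iio_mem_nhds ht] with s hs
        have hs' : s ≤ τ := le_of_lt hs
        simp only [hl, if_pos hs']
      refine ContinuousAt.congr ?_ hev.symm
      exact (continuousAt_clog (hslit t ht.ne)).comp (hgc t)
    · -- locally `l = log (-g) + πi`
      have hev : l =ᶠ[𝓝 τ] fun s => log (-g s) + π * I := by
        filter_upwards [hre_ev] with s hs
        simp only [hl]
        split_ifs with h
        · exact log_eq_log_neg_add_of_im_nonneg hs (him_nonneg s h)
        · rw [log_eq_log_neg_sub_of_im_neg (him_neg s (not_le.1 h))]; ring
      refine ContinuousAt.congr ?_ hev.symm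
      refine ContinuousAt.add ?_ continuousAt_const
      refine (continuousAt_clog ?_).comp (hgc τ).neg
      rw [mem_slitPlane_iff]; left; simp only [neg_re]; linarith
    · have hev : l =ᶠ[𝓝 t] fun s => log (g s) + 2 * π * I := by
        filter_upwards [Ioi_mem_nhds ht] with s hs
        have hs' : ¬ s ≤ τ := not_le.2 hs
        simp only [hl, if_neg hs']
      refine ContinuousAt.congr ?_ hev.symm
      exact ((continuousAt_clog (hslit t ht.ne')).comp (hgc t)).add continuousAt_const
  rw [logInc_eq (f := g) (l := l) (continuousOn_of_forall_continuousAt fun t _ => hlc t)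
    fun t _ => hle t]
  simp only [hl, if_pos hτ0.le, if_neg (not_le.2 hτ1)]
  have e0 : g 0 = crossRatioFn ℓ r A := by simp [hg, hz]
  have e1 : g 1 = crossRatioFn ℓ r B := by simp [hg, hz]
  rw [e0, e1]
  ring

end Literature.Topology.PlaneTopology

/-! ### The variation of the argument of `z - p` along a path -/

namespace Path

open Literature.Topology.PlaneTopology

variable {a b c : ℂ}

/-- The **variation of the argument** (times `i`, plus the variation of `log ‖·‖`) of `z - p`
along the path `γ` in `ℂ`: the increment of a continuous logarithm of `t ↦ γ t - p` on
`[0, 1]` (junk `0` if `p` lies on `γ`). [folklore] -/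
def argInc (γ : Path a b) (p : ℂ) : ℂ := logInc fun t => γ.extend t - p

/-- Off the path, `t ↦ γ t - p` has a continuous logarithm on `[0, 1]`. [folklore] -/
theorem hasLogOn_extend_sub (γ : Path a b) {p : ℂ} (hp : p ∉ range γ) :
    HasLogOn (fun t => γ.extend t - p) (Icc 0 1) := by
  refine hasLogOn_Icc (γ.continuous_extend.continuousOn.sub continuousOn_const) fun t ht h => ?_
  rw [sub_eq_zero, extend_apply γ ht] at h
  exact hp ⟨_, h⟩

/-- **Additivity under concatenation.** [folklore] -/
theorem argInc_trans (γ₁ : Path a b) (γ₂ : Path b c) {p : ℂ} (h₁ : p ∉ range γ₁)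
    (h₂ : p ∉ range γ₂) : (γ₁.trans γ₂).argInc p = γ₁.argInc p + γ₂.argInc p := by
  have hp : p ∉ range (γ₁.trans γ₂) := by
    rw [trans_range]
    rintro (h | h)
    exacts [h₁ h, h₂ h]
  unfold argInc
  rw [logInc_eq_add_halves ((γ₁.trans γ₂).hasLogOn_extend_sub hp)]
  congr 1
  · refine logInc_congr fun t ht => ?_
    rw [extend_trans_of_le_half _ _ (by linarith [ht.2])]
    congr 2
    ring
  · refine logInc_congr fun t ht => ?_
    rw [extend_trans_of_half_le _ _ (by linarith [ht.1])]
    congr 2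
    ring

/-- **Reversal.** [folklore] -/
theorem argInc_symm (γ : Path a b) {p : ℂ} (h : p ∉ range γ) :
    γ.symm.argInc p = -γ.argInc p := by
  unfold argInc
  simp only [extend_symm_apply]
  exact logInc_reverse (f := fun t => γ.extend t - p) (γ.hasLogOn_extend_sub h)

/-- The constant path has zero variation. [folklore] -/
theorem argInc_refl (a p : ℂ) : (Path.refl a).argInc p = 0 := by
  unfold argInc
  show logInc (fun _ : ℝ => a - p) = 0
  exact logInc_const _

/-- **Loops.** For a loop `γ` based at `a` and `p ∉ γ`, the variation of the argument is
`2πi · wind (γ - p)`. [folklore] -/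
theorem argInc_eq_wind_mul (γ : Path a a) {p : ℂ} (h : p ∉ range γ) :
    γ.argInc p = wind (fun t => γ.extend t - p) * (2 * π * I) := by
  refine logInc_eq_wind_mul ⟨γ.continuous_extend.continuousOn.sub continuousOn_const,
    fun t ht h0 => ?_, by simp⟩
  rw [sub_eq_zero, extend_apply γ ht] at h0
  exact h ⟨_, h0⟩

/-- **Principal branch.** If `γ - p` avoids the cut `(-∞, 0]`, the variation is
`log (b - p) - log (a - p)`. [folklore] -/
theorem argInc_eq_log_sub_log (γ : Path a b) {p : ℂ} (h : ∀ t, γ t - p ∈ slitPlane) :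
    γ.argInc p = log (b - p) - log (a - p) := by
  unfold argInc
  rw [logInc_eq_log_sub_log (f := fun t => γ.extend t - p)
    (γ.continuous_extend.continuousOn.sub continuousOn_const)
    fun t ht => by rw [extend_apply γ ht]; exact h _]
  simp

/-! ### The crossing defect of a path relative to a segment -/

/-- The **crossing defect** of the path `γ` relative to the segment `[ℓ, r]`: the increment of
the logarithm of `F ∘ γ`, `F(z) = (z - ℓ)/(z - r)`, minus its principal-branch prediction
`log F(b) - log F(a)`. It vanishes when `γ` avoids `[ℓ, r]`, is additive under concatenation,
and counts (with signs, times `2πi`) the crossings of `γ` over `[ℓ, r]`. [folklore] -/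
def crossInc (γ : Path a b) (ℓ r : ℂ) : ℂ :=
  γ.argInc ℓ - γ.argInc r - (log (crossRatioFn ℓ r b) - log (crossRatioFn ℓ r a))

/-- Additivity of the crossing defect under concatenation (for paths avoiding `ℓ` and `r`).
[folklore] -/
theorem crossInc_trans (γ₁ : Path a b) (γ₂ : Path b c) {ℓ r : ℂ} (hl₁ : ℓ ∉ range γ₁)
    (hl₂ : ℓ ∉ range γ₂) (hr₁ : r ∉ range γ₁) (hr₂ : r ∉ range γ₂) :
    (γ₁.trans γ₂).crossInc ℓ r = γ₁.crossInc ℓ r + γ₂.crossInc ℓ r := by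
  unfold crossInc
  rw [argInc_trans _ _ hl₁ hl₂, argInc_trans _ _ hr₁ hr₂]
  ring

/-- The crossing defect is odd under reversal. [folklore] -/
theorem crossInc_symm (γ : Path a b) {ℓ r : ℂ} (hl : ℓ ∉ range γ) (hr : r ∉ range γ) :
    γ.symm.crossInc ℓ r = -γ.crossInc ℓ r := by
  unfold crossInc
  rw [argInc_symm _ hl, argInc_symm _ hr]
  ring

/-- The constant path has no crossing defect. [folklore] -/
theorem crossInc_refl (a ℓ r : ℂ) : (Path.refl a).crossInc ℓ r = 0 := by
  unfold crossInc
  rw [argInc_refl, argInc_refl]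
  ring

/-- The crossing defect as the defect of `logInc (F ∘ γ)`. [folklore] -/
theorem crossInc_eq (γ : Path a b) {ℓ r : ℂ} (hl : ℓ ∉ range γ) (hr : r ∉ range γ) :
    γ.crossInc ℓ r = logInc (fun t => crossRatioFn ℓ r (γ.extend t)) -
      (log (crossRatioFn ℓ r b) - log (crossRatioFn ℓ r a)) := by
  unfold crossInc argInc
  rw [← logInc_div (γ.hasLogOn_extend_sub hl) (γ.hasLogOn_extend_sub hr)]
  rfl

/-- **A path avoiding the segment has zero crossing defect**: `F ∘ γ` stays in the slit plane,
so its increment is the principal-branch difference. [folklore] -/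
theorem crossInc_eq_zero (γ : Path a b) {ℓ r : ℂ} (h : ∀ t, γ t ∉ segment ℝ ℓ r) :
    γ.crossInc ℓ r = 0 := by
  have hl : ℓ ∉ range γ := by rintro ⟨t, ht⟩; exact h t (ht ▸ left_mem_segment _ _ _)
  have hr : r ∉ range γ := by rintro ⟨t, ht⟩; exact h t (ht ▸ right_mem_segment _ _ _)
  have hcont : ContinuousOn (fun t => crossRatioFn ℓ r (γ.extend t)) (Icc 0 1) := by
    refine continuousOn_of_forall_continuousAt fun t ht => ?_
    have hne : γ.extend t ≠ r := by
      rw [extend_apply γ ht]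
      exact fun h' => h _ (by rw [h']; exact right_mem_segment _ _ _)
    exact (continuousAt_crossRatioFn hne).comp γ.continuous_extend.continuousAt
  rw [crossInc_eq γ hl hr, logInc_eq_log_sub_log hcont]
  · simp
  · intro t ht
    rw [extend_apply γ ht]
    exact crossRatioFn_mem_slitPlane (h _)

/-- **A straight piece crossing the segment once, transversally, has defect `+2πi`** (from the
positive to the negative side of `[ℓ, r]`). [folklore] -/
theorem crossInc_segment_of_cross {A B ℓ r : ℂ} (hA : 0 < segSide ℓ r A) (hB : segSide ℓ r B < 0)
    (hx : ∃ p ∈ segment ℝ A B, p ∈ openSegment ℝ ℓ r) :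
    (Path.segment A B).crossInc ℓ r = 2 * π * I := by
  obtain ⟨hl, hr⟩ := not_mem_segment_of_cross hA hB hx
  rw [← Path.range_segment A B] at hl hr
  rw [crossInc_eq _ hl hr]
  rw [logInc_congr (g := fun t => crossRatioFn ℓ r (AffineMap.lineMap A B t)) fun t ht => by
    simp only; rw [eqOn_extend_segment A B ht]]
  rw [logInc_crossRatioFn_lineMap_of_cross hA hB hx]
  ring

/-- The mirror case: from the negative to the positive side the defect is `-2πi`. [folklore] -/
theorem crossInc_segment_of_cross' {A B ℓ r : ℂ} (hA : segSide ℓ r A < 0) (hB : 0 < segSide ℓ r B)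
    (hx : ∃ p ∈ segment ℝ A B, p ∈ openSegment ℝ ℓ r) :
    (Path.segment A B).crossInc ℓ r = -(2 * π * I) := by
  have hx' : ∃ p ∈ segment ℝ B A, p ∈ openSegment ℝ ℓ r := by
    rw [segment_symm]; exact hx
  have h := crossInc_segment_of_cross hB hA hx'
  obtain ⟨hl, hr⟩ := not_mem_segment_of_cross hB hA hx'
  rw [← Path.range_segment B A] at hl hr
  rw [← Path.segment_symm B A, crossInc_symm _ hl hr, h]

/-- **Loops**: the crossing defect of a loop is `2πi (wind (γ - ℓ) - wind (γ - r))`.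
[folklore] -/
theorem crossInc_loop (γ : Path a a) {ℓ r : ℂ} (hl : ℓ ∉ range γ) (hr : r ∉ range γ) :
    γ.crossInc ℓ r =
      (wind (fun t => γ.extend t - ℓ) - wind (fun t => γ.extend t - r)) * (2 * π * I) := by
  unfold crossInc
  rw [argInc_eq_wind_mul _ hl, argInc_eq_wind_mul _ hr, sub_self, sub_zero]
  ring

end Path

/-! ### Separation of side pairs by a loop -/

namespace Literature.Topology.PlaneTopology

/-- **Crossing-parity separation.** Let the loop `γ` lie in the closed set `K`, and let
`X ⊆ ℂ \ K`. If `ℓa`, `ra` have the *same* winding number and `ℓb`, `rb` have *different*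
winding numbers with respect to `γ`, then the unordered pair of components of `ℓa`, `ra` in `X`
differs from that of `ℓb`, `rb` (given `ℓa, ra ∈ X`): components of `X` lie in components of
`ℂ \ K`, on which the winding number is constant. [folklore] -/
theorem sidePairs_ne_of_wind {a : ℂ} (γ : Path a a) {K X : Set ℂ} (hK : IsClosed K)
    (hγK : range γ ⊆ K) (hX : X ⊆ Kᶜ) {ℓa ra ℓb rb : ℂ} (hℓa : ℓa ∈ X) (hra : ra ∈ X)
    (ha : wind (fun t => γ.extend t - ℓa) = wind (fun t => γ.extend t - ra))
    (hb : wind (fun t => γ.extend t - ℓb) ≠ wind (fun t => γ.extend t - rb)) :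
    ¬ (connectedComponentIn X ℓa = connectedComponentIn X ℓb ∧
        connectedComponentIn X ra = connectedComponentIn X rb) ∧
      ¬ (connectedComponentIn X ℓa = connectedComponentIn X rb ∧
        connectedComponentIn X ra = connectedComponentIn X ℓb) := by
  have hΓ : ContinuousOn γ.extend (Icc 0 1) := γ.continuous_extend.continuousOn
  have h01 : γ.extend 0 = γ.extend 1 := by simp
  have hΓK : MapsTo γ.extend (Icc 0 1) K := fun t ht =>
    hγK (by rw [Path.extend_apply γ ht]; exact ⟨_, rfl⟩)
  -- same component in `X` ⇒ same winding number
  have key : ∀ {p q : ℂ}, p ∈ X → connectedComponentIn X p = connectedComponentIn X q →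
      wind (fun t => γ.extend t - p) = wind (fun t => γ.extend t - q) := by
    intro p q hp hpq
    have hq : q ∈ connectedComponentIn X p := by
      rw [hpq]
      refine mem_connectedComponentIn ?_
      -- `q ∈ X`: otherwise its component is empty, but `p`'s is not
      by_contra hqX
      have h1 : connectedComponentIn X q = ∅ := by
        rw [Set.eq_empty_iff_forall_notMem]
        intro z hz
        exact hqX (connectedComponentIn_nonempty_iff.1 ⟨z, hz⟩)
      have h2 : p ∈ connectedComponentIn X p := mem_connectedComponentIn hp
      rw [hpq, h1] at h2
      exact h2
    exact wind_sub_eq_of_mem_connectedComponentIn hΓ h01 hK hΓK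
      (connectedComponentIn_mono _ hX hq)
  constructor
  · rintro ⟨h1, h2⟩
    exact hb ((key hℓa h1).symm.trans (ha.trans (key hra h2)))
  · rintro ⟨h1, h2⟩
    exact hb ((key hra h2).symm.trans (ha.symm.trans (key hℓa h1)))

end Literature.Topology.PlaneTopology
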